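import Mathlib
import Literature.Geometry.Riemannian.GaussianShrinker
import HarnessLib

/-!
# Compactness is load-bearing in the entropy-gap characterisation of `S⁴` (Gaussian shrinker)

Topic `Literature/Geometry/Riemannian` (librarian move 2026-08-16 of the gate-parked module
`Literature/Uncategorized/WithoutCompactHomotopy.lean`; declarations byte-identical, only the
namespace — this directory's — is new; the old names remain as deprecated aliases). Everything is
evaluated on the Gaussian shrinker of `Literature/Geometry/Riemannian/GaussianShrinker.lean`.

* `Literature.Geometry.Riemannian.WithoutCompactHomotopy` — the route crux
  `EntropyRung.CompactShrinkerGap` of `Summits/SmoothPoincare4` (a gradient shrinker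
  `Ric + Hess f = g/2`, `R + |∇f|² = f` on a 4-manifold with `∫ e^{-f} > 32π²√π e^{-3/2}` is
  diffeomorphic to `S⁴`) with its hypotheses `[CompactSpace M]` and `M ≃ₕ S⁴` deleted, all other
  sub-terms verbatim. A refuted weakening minted by the crux's refuter, kept as the named target
  of its refutation (negative knowledge; not a literature fact, no `_holds`).
* `Literature.Geometry.Riemannian.WithoutCompactHomotopy_false` — **it is FALSE**: the Gaussian
  shrinker `(ℝ⁴, δ, |x|²/4)` satisfies every analytic hypothesis with
  `∫ e^{-f} dx = 16π² > 32π²√π e^{-3/2}` (Cao–Hamilton–Ilmanen 2004, §4: `Θ(ℝ⁴) = 1 > Θ(S³×ℝ)`),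
  while `ℝ⁴` is non-compact, hence not diffeomorphic to `S⁴`.

Origin: refuter of crux `CompactShrinkerGap`, proposal relocated by the gate out of
`Summits/SmoothPoincare4/SmoothPoincare4/Theorems/CompactShrinkerGap/Negative/WithoutCompactHomotopyFalse.lean`
(2026-08-15), which still states `¬ Literature.Uncategorized.WithoutCompactHomotopy` by the old
name (it keeps compiling through the alias; provers may switch to this module's name).

## References

* H.-D. Cao, R. S. Hamilton, T. Ilmanen, *Gaussian densities and stability for some Ricci solitons*,
  arXiv:math/0404165 (2004), §4. [CaoHamiltonIlmanen2004]
-/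

namespace Literature.Geometry.Riemannian

open scoped Manifold ContDiff ENNReal RealInnerProductSpace ContinuousMap
open MeasureTheory
open Literature.Geometry.Lorentzian
open Literature.Geometry.Lorentzian.PseudoRiemannianMetric

/-- `EntropyRung.CompactShrinkerGap` with `[CompactSpace M]` and `M ≃ₕ S⁴` deleted, all other
sub-terms verbatim. [folklore] -/
def WithoutCompactHomotopy : Prop :=
  ∀ (M : Type) [TopologicalSpace M] [T2Space M] [SecondCountableTopology M]
    [ChartedSpace (EuclideanSpace ℝ (Fin 4)) M] [IsManifold (𝓡 4) ∞ M] [T3Space M]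
    [MeasurableSpace M] [BorelSpace M],
    ∀ (g : PseudoRiemannianMetric (𝓡 4) ∞ (EuclideanSpace ℝ (Fin 4)) (TangentSpace (𝓡 4) : M → Type _))
      [g.HasLeviCivita] (f : M → ℝ) (hg : g.IsRiemannian), ContMDiff (𝓡 4) 𝓘(ℝ, ℝ) ∞ f →
      (∀ (x : M) (X Y : TangentSpace (𝓡 4) x), g.ricci x X Y + g.hessian f x X Y = (1 / 2 : ℝ) * g.val x X Y) →
      (∀ x : M, g.scalarCurvature x + g.gradSq f x = f x) →
      ENNReal.ofReal (32 * Real.pi ^ 2 * Real.sqrt Real.pi * Real.exp (-(3 : ℝ) / 2)) <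
        ∫⁻ x, ENNReal.ofReal (Real.exp (-f x)) ∂(riemannianMeasure (g.toContMDiffRiemannianMetric hg)) →
      Nonempty (M ≃ₘ⟮𝓡 4, 𝓡 4⟯ (Metric.sphere (0 : EuclideanSpace ℝ (Fin 5)) 1))

/-- **`WithoutCompactHomotopy` is false** (so it can never be discharged): the Gaussian shrinker
`(ℝ⁴, δ, f = |x|²/4)` has `Ric + Hess f = δ/2`, `R + |∇f|² = f` and
`∫ e^{-f} dx = 16π² > 32π²√π e^{-3/2}` (Gaussian density `Θ(ℝ⁴) = 1 > Θ(S³ × ℝ) ≈ .791`,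
[cite: CaoHamiltonIlmanen2004, §4]), yet `ℝ⁴` is non-compact and `S⁴` is compact, so no
diffeomorphism `ℝ⁴ ≃ₘ S⁴` exists. Every clause is evaluated in
`Literature.Geometry.Riemannian.GaussianShrinker`; this mirrors the `Summits`-side negative lemma
`Summit.SmoothPoincare4.SmoothPoincare4.Theorems.CompactShrinkerGap.Negative.withoutCompactHomotopy_false`
(which `Literature` may not import) so that the relocated def carries its refutation in its own module. -/
theorem WithoutCompactHomotopy_false : ¬ WithoutCompactHomotopy := by
  intro h
  have hne := h EuclideanFour (euclideanMetric EuclideanFour) gaussianPotential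
    isRiemannian_euclideanMetric contDiff_gaussianPotential.contMDiff
    (fun x X Y ↦ by
      rw [ricci_euclideanMetric, hessian_gaussianPotential, euclideanMetric_apply]
      simp only [LinearMap.zero_apply, zero_add]
      rw [div_eq_inv_mul, one_div]
      rfl)
    (fun x ↦ by rw [scalarCurvature_euclideanMetric, gradSq_gaussianPotential, zero_add])
    (by
      change ENNReal.ofReal _ <
        ∫⁻ x, ENNReal.ofReal (Real.exp (-gaussianPotential x)) ∂(riemannianMeasure euclideanFourMetric)
      rw [riemannianMeasure_euclideanFour, lintegral_exp_neg_gaussianPotential]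
      exact (ENNReal.ofReal_lt_ofReal_iff (by positivity)).mpr cylinderDensityBound_lt_gaussian)
  obtain ⟨Φ⟩ := hne
  haveI : CompactSpace EuclideanFour := Φ.toHomeomorph.symm.compactSpace
  exact not_compactSpace_iff.mpr (inferInstance : NoncompactSpace EuclideanFour) this

end Literature.Geometry.Riemannian
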